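import Literature.NumberTheory.ComplexMultiplication.CMTypeGaloisTranslateReflexField
import Literature.NumberTheory.ComplexMultiplication.CMAlgebraReflexField
import Literature.NumberTheory.ComplexMultiplication.CMTypeInducedFromPrimitive
import Literature.NumberTheory.ComplexMultiplication.QuarticCMTypesEquivalenceClasses
import HarnessLib

/-!
# Galois classes of INDUCED CM types: `τ(Ψ^K) = (τΨ)^K`, the class of `Ψ^K` has `[K*_Ψ : ℚ]` members (Milne Prop. 1.18
# (c): the reflex field of `Ψ^K` is that of `Ψ`); types induced from an imaginary quadratic subfield form the Galois
# classes `{Φ, Φ̄}` (DIS 2022 Props. 10–11: the one imprimitive class)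

Layer `Literature/NumberTheory/ComplexMultiplication`, namespace `Literature.NumberTheory.ComplexMultiplication` (lane
`lit-hodgefound`, Track 2 foundations, Layer A3; seat `lit-hodgefound-p11`, generation 24, row g24-#10).  Sequel of
`CMTypeGaloisEquivalence` (g24-#5), `CMTypeGaloisClassReflexDegree` (g24-#6: the Galois class of `Φ` has `[ℚ(tr_Φ) : ℚ]`
members), `CMTypeGaloisTranslateReflexField` (g24-#7) on the tree's `inducedCMType` (Streng Def. 3.2 `Ψ^K`),
`CMAlgebraReflexField.traceField_inducedCMType` (Milne Prop. 1.18 (c): `ℚ(tr_{Ψ^K}) = ℚ(tr_Ψ)`),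
`CMTypeInducedFromPrimitive.isCMField_of_cmType_intermediateField` and `CMTypeCount` (quadratic fields: `single`,
`finrank_traceField_single`, `bar_single`).  THEOREMS ONLY; no definition, no named fact (D-0026).

THE PRINT.  J. S. Milne, *Complex Multiplication* (2006), Ch. I §1 Prop. 1.18 (c): the reflex field of the extension
`Φ_L` of a CM type `Φ` of `K ⊆ L` is the reflex field of `Φ`; B. Dina, S. Ionica, J. Sijsling (2022) §1.2 Def. 8 and
Props. 10–11: for a sextic CM field containing an imaginary quadratic field (`C₆`, `D₆`) there is, up to Galois
equivalence, exactly «`1` imprimitive» CM type — the class `{Φ, Φ̄}` of the two types «induced by the unique quadratic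
CM subfield»; B. Dodson (1984) §1.3 Remark («`[K′ : ℚ]` is also the order of the orbit of `Φ`») and §3.1.1 (the
imaginary quadratic subfield case).

WHAT IS PROVED (`K` a CM field).
* §1 (`k` a CM field, `j : k → K`): **`cmTypeSmul_inducedCMType` (`τ(Ψ^K) = (τΨ)^K`)** — induction commutes with the
  Galois translation (whereas Streng twists move the subfield, g24-#2 `exists_inducedCMType_twist`); Galois-equivalent
  `Ψ, Ψ′` induce Galois-equivalent types; **`traceField_inducedCMType_ringHom`** (`ℚ(tr_{Ψ^K}) = ℚ(tr_Ψ)`, Milne 1.18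
  (c) along any embedding) and **`natCard_galoisClass_inducedCMType_eq`**: the Galois classes of `Ψ^K` (in `K`) and of
  `Ψ` (in `k`) have the same number of members, `[ℚ(tr_Ψ) : ℚ]`.
* §2 (`k ⊆ K` an intermediate field carrying a CM type — then `k` is CM): the Galois class of an induced type
  consists of types induced FROM THE SAME SUBFIELD (`exists_eq_inducedCMType_of_rel`); its size is `[ℚ(tr_Ψ) : ℚ]`.
* §3 (`k ⊆ K` imaginary quadratic, `[k : ℚ] = 2`): `finrank_traceField_eq_two_of_finrank_eq_two` (`[ℚ(tr_Ψ) : ℚ] = 2`),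
  **`natCard_galoisClass_inducedCMType_eq_two`**, **`rel_inducedCMType_iff_eq_or_eq_bar`** (the Galois class of
  `Φ = Ψ^K` is exactly `{Φ, Φ̄}`), `inducedCMType_bar`; **`card_cmTypeGaloisClasses_induced_eq_one`**: the types of `K`
  induced from `k` form exactly ONE Galois class («`1` imprimitive»); and for `[K : ℚ] ≥ 4`:
  **`two_le_card_cmTypeGaloisClasses_of_quadratic`** — a CM field of degree `≥ 4` with an imaginary quadratic subfield
  has at least two Galois classes (the class `{Φ, Φ̄}` has `2 < 2^g` members).

## References

* [MilneCM2006] J. S. Milne, *Complex Multiplication* (2006), Ch. I §1 Prop. 1.18 (c).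
* [DinaIonicaSijsling2022] B. Dina, S. Ionica, J. Sijsling, Math. Comp. 91 (2022), §1.2 Def. 8, Props. 10–11.
* [Dodson1984] B. Dodson, Trans. AMS 283 (1984), §1.3 Remark (p. 5), §3.1.1.
* [Streng2010] M. Streng, thesis (2010), Ch. I Def. 3.2, Lemma 3.4, Lemma 3.5.

## Provenance

Lane `lit-hodgefound` (HOME `run/shared/lean/pub/lit-hodgefound/`), prover seat `lit-hodgefound-p11` (gen 24),
self-proposed row g24-#10 (INBOX claim 2026-08-27, l.40244).
-/

set_option autoImplicit false

noncomputable section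

open scoped Classical NumberField Pointwise
open NumberField Module IntermediateField

namespace Literature.NumberTheory.ComplexMultiplication

open Literature.AlgebraicGeometry.Motives (CMType)
open Literature.AlgebraicGeometry.Motives.HodgeStructure (cmTypeSmul cmTypeSmul_val)

variable {K : Type} [Field K] [NumberField K] [IsCMField K]

/-! ## §1 Induction commutes with Galois translation; the class of `Ψ^K` has `[K*_Ψ : ℚ]` members -/

section Embedding

variable {k : Type} [Field k] [NumberField k] [IsCMField k]

/-- **`τ(Ψ^K) = (τΨ)^K`**: the Galois translate of an induced type is the type induced from the translate
(`τ ∘ (ψ ∘ j) = (τ ∘ ψ) ∘ j`). [cite: DinaIonicaSijsling2022, §1.2 Def. 8] [cite: Streng2010, Ch. I Def. 3.2] -/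
theorem cmTypeSmul_inducedCMType (τ : ℂ ≃+* ℂ) (j : k →+* K) (Ψ : CMType k) :
    cmTypeSmul τ (inducedCMType j Ψ) = inducedCMType j (cmTypeSmul τ Ψ) :=
  Subtype.ext (Set.ext fun ψ => by
    rw [mem_cmTypeSmul_iff, mem_inducedCMType_iff, mem_inducedCMType_iff, mem_cmTypeSmul_iff]
    exact Iff.rfl)

/-- Galois-equivalent types of `k` induce Galois-equivalent types of `K`. [cite: DinaIonicaSijsling2022, §1.2 Def. 8]
[cite: Streng2010, Ch. I Def. 3.2] -/
theorem cmTypeGaloisSetoid_r_inducedCMType (j : k →+* K) {Ψ Ψ' : CMType k} (h : (cmTypeGaloisSetoid k).r Ψ Ψ') :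
    (cmTypeGaloisSetoid K).r (inducedCMType j Ψ) (inducedCMType j Ψ') := by
  obtain ⟨τ, rfl⟩ := h
  exact ⟨τ, (cmTypeSmul_inducedCMType τ j Ψ).symm⟩

/-- Every type Galois equivalent to `Ψ^K` is `(τΨ)^K` for some `τ`. [cite: DinaIonicaSijsling2022, §1.2 Def. 8]
[cite: Streng2010, Ch. I Def. 3.2] -/
theorem exists_eq_inducedCMType_cmTypeSmul_of_rel (j : k →+* K) (Ψ : CMType k) {Θ : CMType K}
    (h : (cmTypeGaloisSetoid K).r (inducedCMType j Ψ) Θ) : ∃ τ : ℂ ≃+* ℂ, Θ = inducedCMType j (cmTypeSmul τ Ψ) := by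
  obtain ⟨τ, rfl⟩ := h
  exact ⟨τ, cmTypeSmul_inducedCMType τ j Ψ⟩

omit [IsCMField K] [IsCMField k] in
/-- **Milne Prop. 1.18 (c) along an embedding: `ℚ(tr_{Ψ^K}) = ℚ(tr_Ψ)`** (the tree's `traceField_inducedCMType` for the
algebra structure defined by `j`). [cite: MilneCM2006, Ch. I §1 Prop. 1.18 (c)] -/
theorem traceField_inducedCMType_ringHom (j : k →+* K) (Ψ : CMType k) :
    traceField (inducedCMType j Ψ) = traceField Ψ := by
  letI : Algebra k K := j.toAlgebra
  exact traceField_inducedCMType k K Ψ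

/-- **The Galois classes of `Ψ^K` and of `Ψ` have the same number of members**, namely `[ℚ(tr_Ψ) : ℚ]` (g24-#6 twice
and Prop. 1.18 (c)). [cite: MilneCM2006, Ch. I §1 Prop. 1.18 (c)] [cite: Dodson1984, §1.3 Remark (p. 5)] -/
theorem natCard_galoisClass_inducedCMType_eq (j : k →+* K) (Ψ : CMType k) :
    Nat.card {Θ : CMType K // ∃ τ : ℂ ≃+* ℂ, Θ = cmTypeSmul τ (inducedCMType j Ψ)} =
      Nat.card {Ψ' : CMType k // ∃ τ : ℂ ≃+* ℂ, Ψ' = cmTypeSmul τ Ψ} := by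
  rw [natCard_galoisClass_eq_finrank_traceField, natCard_galoisClass_eq_finrank_traceField,
    traceField_inducedCMType_ringHom]

omit [IsCMField k] in
/-- The Galois class of `Ψ^K` has `[ℚ(tr_Ψ) : ℚ]` members. [cite: MilneCM2006, Ch. I §1 Prop. 1.18 (c)]
[cite: Dodson1984, §1.3 Remark (p. 5)] -/
theorem natCard_galoisClass_inducedCMType_eq_finrank (j : k →+* K) (Ψ : CMType k) :
    Nat.card {Θ : CMType K // ∃ τ : ℂ ≃+* ℂ, Θ = cmTypeSmul τ (inducedCMType j Ψ)} = finrank ℚ (traceField Ψ) := by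
  rw [natCard_galoisClass_eq_finrank_traceField, traceField_inducedCMType_ringHom]

end Embedding

/-! ## §2 Intermediate fields: the Galois class of an induced type stays induced from the same subfield -/

section Intermediate

/-- **A type Galois equivalent to a type induced from `k ⊆ K` is induced from THE SAME `k`** (contrast: a Streng twist
by `σ` yields a type induced from `σ⁻¹(k)`, g24-#2 `exists_inducedCMType_twist`).  (`k` carries a CM type, so it is a
CM field: `isCMField_of_cmType_intermediateField`.) [cite: DinaIonicaSijsling2022, §1.2 Def. 8 and Prop. 11]
[cite: Streng2010, Ch. I Def. 3.2 and Lemma 3.5] -/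
theorem exists_eq_inducedCMType_of_rel (k : IntermediateField ℚ K) (Ψ : CMType k) {Θ : CMType K}
    (h : (cmTypeGaloisSetoid K).r (inducedCMType (algebraMap k K) Ψ) Θ) :
    ∃ Ψ' : CMType k, Θ = inducedCMType (algebraMap k K) Ψ' := by
  haveI := isCMField_of_cmType_intermediateField k Ψ
  obtain ⟨τ, hτ⟩ := exists_eq_inducedCMType_cmTypeSmul_of_rel (algebraMap k K : k →+* K) Ψ h
  exact ⟨_, hτ⟩

/-- The family of types induced from `k` is a union of Galois classes. [cite: DinaIonicaSijsling2022, §1.2 Def. 8 and Prop. 11] -/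
theorem exists_inducedCMType_eq_of_rel (k : IntermediateField ℚ K) {Φ Θ : CMType K}
    (hΦ : ∃ Ψ : CMType k, inducedCMType (algebraMap k K) Ψ = Φ) (h : (cmTypeGaloisSetoid K).r Φ Θ) :
    ∃ Ψ' : CMType k, inducedCMType (algebraMap k K) Ψ' = Θ := by
  obtain ⟨Ψ, rfl⟩ := hΦ
  obtain ⟨Ψ', hΨ'⟩ := exists_eq_inducedCMType_of_rel k Ψ h
  exact ⟨Ψ', hΨ'.symm⟩

end Intermediate

/-! ## §3 Types induced from an imaginary quadratic subfield: the Galois classes `{Φ, Φ̄}` -/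

section Quadratic

omit [IsCMField K] in
/-- A CM type of a quadratic field `k` has reflex field `≅ k`, of degree `2` (`Ψ = {ψ}`, `tr_Ψ = ψ`; tree
`CMTypeCount.finrank_traceField_single`). [cite: Streng2010, Ch. I Lemma 3.4 (1), p. 21] [cite: Shimura1998, §8.3 Prop. 28] -/
theorem finrank_traceField_eq_two_of_finrank_eq_two {k : Type} [Field k] [NumberField k] (h2 : finrank ℚ k = 2)
    (Ψ : CMType k) : finrank ℚ (traceField Ψ) = 2 := by
  haveI := CMTypeLattice.isTotallyComplex_of_cmType Ψ
  obtain ⟨ψ, rfl⟩ := CMTypeCount.exists_eq_single h2 Ψ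
  exact CMTypeCount.finrank_traceField_single h2 ψ

omit [NumberField K] [IsCMField K] in
/-- `(Ψ̄)^K = \overline{Ψ^K}`. [cite: Streng2010, Ch. I Def. 3.1 and Def. 3.2] -/
theorem inducedCMType_bar {k : Type} [Field k] (j : k →+* K) (Ψ : CMType k) :
    inducedCMType j (CMTypeOps.bar Ψ) = CMTypeOps.bar (inducedCMType j Ψ) :=
  Subtype.ext (Set.ext fun ψ => by
    rw [mem_inducedCMType_iff, CMTypeOps.mem_bar_iff, CMTypeOps.mem_bar_iff, mem_inducedCMType_iff])

variable (k : IntermediateField ℚ K)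

/-- **The Galois class of a type induced from an imaginary quadratic subfield has exactly TWO members.**
[cite: DinaIonicaSijsling2022, §1.2 Props. 10–11] [cite: Dodson1984, §1.3 Remark (p. 5) and §3.1.1] -/
theorem natCard_galoisClass_inducedCMType_eq_two (h2 : finrank ℚ k = 2) (Ψ : CMType k) :
    Nat.card {Θ : CMType K // ∃ τ : ℂ ≃+* ℂ, Θ = cmTypeSmul τ (inducedCMType (algebraMap k K) Ψ)} = 2 := by
  rw [natCard_galoisClass_inducedCMType_eq_finrank, finrank_traceField_eq_two_of_finrank_eq_two h2]

/-- **… namely `Φ` and `Φ̄`: `Θ ~_{Gal} Ψ^K ↔ Θ = Ψ^K ∨ Θ = \overline{Ψ^K}`.** [cite: DinaIonicaSijsling2022, §1.2 Props. 10–11]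
[cite: Streng2010, Ch. I Lemma 3.4 (1), p. 21] -/
theorem rel_inducedCMType_iff_eq_or_eq_bar (h2 : finrank ℚ k = 2) (Ψ : CMType k) (Θ : CMType K) :
    (cmTypeGaloisSetoid K).r (inducedCMType (algebraMap k K) Ψ) Θ ↔
      Θ = inducedCMType (algebraMap k K) Ψ ∨ Θ = CMTypeOps.bar (inducedCMType (algebraMap k K) Ψ) := by
  haveI : Finite (CMType K) := finite_cmType
  set Φ := inducedCMType (algebraMap k K) Ψ with hΦ
  constructor
  · intro h
    by_contra hne
    push Not at hne
    -- three distinct members `Φ, Φ̄, Θ` of a class with two members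
    have h3 : Nat.card ({x // x ∈ ({Φ, CMTypeOps.bar Φ, Θ} : Finset (CMType K))}) = 3 := by
      rw [Nat.card_eq_fintype_card, Fintype.card_coe, Finset.card_insert_of_notMem, Finset.card_pair hne.2.symm]
      simp only [Finset.mem_insert, Finset.mem_singleton, not_or]
      exact ⟨(CMTypeOps.bar_ne_self Φ).symm, hne.1.symm⟩
    have hle : Nat.card ({x // x ∈ ({Φ, CMTypeOps.bar Φ, Θ} : Finset (CMType K))}) ≤
        Nat.card {Θ' : CMType K // ∃ τ : ℂ ≃+* ℂ, Θ' = cmTypeSmul τ Φ} := by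
      refine Nat.card_le_card_of_injective (fun x => ⟨x.1, ?_⟩) fun x y hxy => Subtype.ext (by
        have h' := Subtype.ext_iff.1 hxy
        exact h')
      rcases Finset.mem_insert.1 x.2 with hx | hx
      · exact ⟨1, by rw [hx, cmTypeSmul_one]⟩
      rcases Finset.mem_insert.1 hx with hx | hx
      · exact ⟨starRingAut, by rw [hx, cmTypeSmul_starRingAut]⟩
      · rw [Finset.mem_singleton] at hx
        obtain ⟨τ, hτ⟩ := h
        exact ⟨τ, by rw [hx, hτ]⟩
    rw [h3, hΦ, natCard_galoisClass_inducedCMType_eq_two k h2 Ψ] at hle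
    omega
  · rintro (rfl | rfl)
    · exact (cmTypeGaloisSetoid K).refl _
    · exact cmTypeGaloisSetoid_r_bar _

/-- **The types of `K` induced from the imaginary quadratic subfield `k` form exactly ONE Galois class** (they are
`ψ^K` and `ψ̄^K = \overline{ψ^K}`; «`1` of them imprimitive» up to Galois equivalence, DIS Props. 10–11).
[cite: DinaIonicaSijsling2022, §1.2 Props. 10–11] [cite: Streng2010, Ch. I Lemma 3.4 (1), p. 21] -/
theorem card_cmTypeGaloisClasses_induced_eq_one (h2 : finrank ℚ k = 2) (Ψ₀ : CMType k) :
    Nat.card {q : Quotient (cmTypeGaloisSetoid K) // ∀ Φ : CMType K, Quotient.mk _ Φ = q →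
        ∃ Ψ : CMType k, inducedCMType (algebraMap k K) Ψ = Φ} = 1 := by
  haveI : Finite (CMType K) := finite_cmType
  haveI := CMTypeLattice.isTotallyComplex_of_cmType Ψ₀
  have hmem : ∀ Ψ : CMType k, ∀ Φ : CMType K,
      Quotient.mk (cmTypeGaloisSetoid K) Φ = Quotient.mk _ (inducedCMType (algebraMap k K) Ψ) →
        ∃ Ψ' : CMType k, inducedCMType (algebraMap k K) Ψ' = Φ := fun Ψ Φ h =>
    exists_inducedCMType_eq_of_rel k ⟨Ψ, rfl⟩ (Quotient.exact h.symm)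
  haveI := isCMField_of_cmType_intermediateField k Ψ₀
  rw [Nat.card_eq_one_iff_unique]
  refine ⟨⟨fun q q' => Subtype.ext ?_⟩, ⟨⟨Quotient.mk _ (inducedCMType (algebraMap k K) Ψ₀), hmem Ψ₀⟩⟩⟩
  obtain ⟨q, hq⟩ := q
  obtain ⟨q', hq'⟩ := q'
  obtain ⟨Φ, rfl⟩ := Quotient.exists_rep q
  obtain ⟨Φ', rfl⟩ := Quotient.exists_rep q'
  obtain ⟨Ψ, rfl⟩ := hq _ rfl
  obtain ⟨Ψ', rfl⟩ := hq' _ rfl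
  change Quotient.mk (cmTypeGaloisSetoid K) _ = Quotient.mk _ _
  refine Quotient.sound ((rel_inducedCMType_iff_eq_or_eq_bar k h2 Ψ _).2 ?_)
  obtain ⟨ψ, rfl⟩ := CMTypeCount.exists_eq_single h2 Ψ
  rcases CMTypeCount.eq_single_or_eq_single_conjugate h2 Ψ' ψ with rfl | rfl
  · exact Or.inl rfl
  · exact Or.inr (by rw [← CMTypeCount.bar_single h2, inducedCMType_bar])

/-- **A CM field of degree `≥ 4` with an imaginary quadratic subfield carrying a CM type has at least TWO Galois
classes** (the class `{ψ^K, ψ̄^K}` has `2 < 2^g` members). [cite: DinaIonicaSijsling2022, §1.2 Props. 10–11]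
[cite: Dodson1984, §3.1.1] -/
theorem two_le_card_cmTypeGaloisClasses_of_quadratic (h2 : finrank ℚ k = 2) (h4 : 4 ≤ finrank ℚ K) (Ψ : CMType k) :
    2 ≤ Nat.card (Quotient (cmTypeGaloisSetoid K)) := by
  haveI := finite_cmTypeGaloisClasses (K := K)
  haveI : Finite (CMType K) := finite_cmType
  by_contra hlt
  have hpos : 0 < Nat.card (Quotient (cmTypeGaloisSetoid K)) :=
    Nat.card_pos_iff.2 ⟨⟨Quotient.mk _ (inducedCMType (algebraMap k K) Ψ)⟩, inferInstance⟩
  have h1 : Nat.card (Quotient (cmTypeGaloisSetoid K)) = 1 := by omega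
  -- one class: the class of `Ψ^K` is everything, but it has `2` members and there are `2^g ≥ 4` types
  haveI : Subsingleton (Quotient (cmTypeGaloisSetoid K)) := (Nat.card_eq_one_iff_unique.1 h1).1
  have hall : ∀ Θ : CMType K, ∃ τ : ℂ ≃+* ℂ, Θ = cmTypeSmul τ (inducedCMType (algebraMap k K) Ψ) := fun Θ =>
    Quotient.exact (Subsingleton.elim (Quotient.mk (cmTypeGaloisSetoid K) (inducedCMType (algebraMap k K) Ψ))
      (Quotient.mk _ Θ))
  have hcard := natCard_galoisClass_inducedCMType_eq_two k h2 Ψ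
  rw [Nat.card_congr (Equiv.subtypeUnivEquiv hall), CMTypeCount.natCard_cmType] at hcard
  have h2g : 2 ≤ finrank ℚ K / 2 := by omega
  have : (2 : ℕ) ^ 2 ≤ 2 ^ (finrank ℚ K / 2) := Nat.pow_le_pow_right (by norm_num) h2g
  omega

end Quadratic

end Literature.NumberTheory.ComplexMultiplication
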